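import Literature.NumberTheory.Automorphic.UnitaryGroupAutomorphicRep      -- ★ `UnitaryGroup.PlacesOver E v = {w : HeightOneSpectrum (𝓞 E) // w.under (𝓞 F) = v}`
import Mathlib.NumberTheory.NumberField.CMField                             -- `NumberField.maximalRealSubfield`, `IsCMField`
import Mathlib.RingTheory.Unramified.Locus                                  -- `Algebra.IsUnramifiedIn`
import HarnessLib

/-!
# R90-TF · S10 (Ch. 13.5–13.8 comparison) — the ⟪U⟫ → ★ unit-FL guard SPELLING BRIDGE:
# «every place `W ∣ w` of `L` is unramified over `L⁺`» ⇒ «`w` is unramified in `𝓞 L`»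

Cell `hodgecm-mathlib`, crux H413 (`stmt-HodgeConjecture-24833`, lane `--supports`, helper), route of record `HCCMUnconditional` (count-neutral).
Programme R90-TF, section S10 = Ch. 13.5–13.8 (base `R90-C138`), dealer R90-C138-plan (g0) DEAL 22:33:12Z (3) → seat R90-C131-p03 (g0) (S10 PEN);
junction J-A2c-2 / memo `R90/R90-C131-p03/g0/S10/MEMO-A2c-unitFL-currency.md` §3.  ONE THEOREM, hypothesis-free, no `def`, no instance, no `sorry`.

MATHEMATICS.  FILE A (v3/v4) of S10 guards its sockets A2a/A2c/A2d by the token ⟪U⟫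
`∀ W : PlacesOver L w, Algebra.IsUnramifiedAt (𝓞 L⁺) W.1.asIdeal ∧ μ.IsUnramifiedAt W.1` [Rogawski1990, §4.9 Prop. 4.9.1 (b) p. 55: «E∕F is unramified,
and the characters μ and ω are unramified»], while the tree's unit fundamental lemma (★ `isLocalUnitTransfer_of_nonsplit_of_isUnit_two`,
★ `unitFundamentalLemmaExplicitNonsplit_of_forall_place`) spells the field condition as Mathlib's `Algebra.IsUnramifiedIn (𝓞 L) w.asIdeal`
(`RingTheory/Unramified/Locus.lean`: every prime `𝔓` of `𝓞 L` lying over `w` is `Algebra.IsUnramifiedAt (𝓞 L⁺) 𝔓`).  The two agree because a prime of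
`𝓞 L` over the non-zero prime `w` is non-zero (Mathlib `Ideal.ne_bot_of_liesOver_of_ne_bot`), hence a finite place `W` of `L` with `W.under (𝓞 L⁺) = w`
(Mathlib `HeightOneSpectrum.under`, `Ideal.LiesOver.over`).  [cite: Rogawski1990, §4.9 Prop. 4.9.1 (b) p. 55] [cite: Neukirch1999, Ch. I §8 p. 49]
HONEST LABEL: a spelling bridge; pays no socket by itself; HC_CM is proved only modulo the 7 printed citations (2 remaining named inputs: hLiu418 =
stmt-HodgeConjecture-24832, h413 = stmt-HodgeConjecture-24833) until rung 0 closes; REL ≠ ★ ≠ BUILT.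
-/

set_option autoImplicit false
set_option linter.dupNamespace false

open NumberField IsDedekindDomain
open Literature.NumberTheory.Automorphic

namespace Summit.HodgeConjecture.HodgeConjecture.R90.S10

/-- **⟪U⟫ ⇒ the ★ unit-FL field guard.**  If every finite place `W` of the CM field `L` above the finite place `w` of `L⁺` is unramified over `𝓞 L⁺`
(`Algebra.IsUnramifiedAt (𝓞 L⁺) W.1.asIdeal`, the spelling of S10 FILE A's ⟪U⟫), then `w` is unramified in `𝓞 L` in Mathlib's sense
(`Algebra.IsUnramifiedIn (𝓞 L) w.asIdeal`, the spelling of ★ `isLocalUnitTransfer_of_nonsplit_of_isUnit_two`'s hypothesis `hv`).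
[cite: Rogawski1990, §4.9 Prop. 4.9.1 (b) p. 55] [cite: Neukirch1999, Ch. I §8 p. 49] -/
theorem isUnramifiedIn_of_forall_placesOver (L : Type) [Field L] [NumberField L] [IsCMField L]
    (w : HeightOneSpectrum (𝓞 ↥(maximalRealSubfield L)))
    (h : ∀ W : UnitaryGroup.PlacesOver L w, Algebra.IsUnramifiedAt (𝓞 ↥(maximalRealSubfield L)) W.1.asIdeal) :
    Algebra.IsUnramifiedIn (R := 𝓞 ↥(maximalRealSubfield L)) (𝓞 L) w.asIdeal := by
  intro 𝔓 h𝔓 hover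
  have hne : 𝔓 ≠ ⊥ := Ideal.ne_bot_of_liesOver_of_ne_bot w.ne_bot 𝔓
  have hW : (⟨𝔓, h𝔓, hne⟩ : HeightOneSpectrum (𝓞 L)).under (𝓞 ↥(maximalRealSubfield L)) = w :=
    HeightOneSpectrum.ext hover.over.symm
  exact h ⟨⟨𝔓, h𝔓, hne⟩, hW⟩

end Summit.HodgeConjecture.HodgeConjecture.R90.S10
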